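import Summits.BirchSwinnertonDyer.Rank1Residual.GaloisImage.WildThreeAdicTower
import HarnessLib

/-!
# The non-canonical root of the level-`3` Hauptmodul quartic at `v₃(j) = 4`:
# `v(ρ)³ = v(3)` and `v(9(2 + ρ)² − ρ⁶)³ = v(3)⁷`
# (cell `b2b-bsdres`, team n1011, seat p02 gen 5 — row T-b11-F4, file F4c-H1 'Hauptmodul route,
# curve-free core, part 1'; pure valuation algebra in `ℚ̄`, no elliptic curve in the statements)

HONEST FRAMING (cell `b2b-bsdres`, run/shared/lean/b2b/bsd-rank1-residual/, verbatim in every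
file): the goal of the cell is to DELETE the COMBINATION-SHAPED residual classes of the
Birch–Swinnerton-Dyer formula for ALL analytic-rank `≤ 1` elliptic curves over `ℚ` — "full BSD
formula for every rank `≤ 1` curve in class `C`" assembled STRICTLY from published theorems — so
that the rank-`≤ 1` remainder becomes exactly the CONSTRUCTION-SHAPED classes, which are TYPED
(missing-input `Prop`s), NOT attempted. This is not "finishing BSD". Team n1011 (N10 / N11):
research route; no claim beyond the stated classes; labels UNCHANGED; nothing is booked. Theorems
only (no definition, no named fact).

## What this file proves (M3-LOCAL-NOTE §8.3 "v₃(j) = 4 is valuation-forced", first half)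

Let `v` be the place of `ℚ̄` over `3`, `t = v(3)`.  For an elliptic curve `E/ℚ` and a cyclic
subgroup `C ⊂ E[9]`, the level-`9` Hauptmodul `η = η(E, C)` (`KleinFrickeLevelNine`) gives, with
`θ = η + 3`, `S = θ³`, the level-`3` relation **`j(S − 27) = S(S − 24)³`**
(`KleinFrickeLevelTwentySeven.level_nine_three_smul`), `v(S) = v(3)` when `3C` is not the
canonical subgroup.  Write `S = 3(2 + ρ)`, `J = j/81`.  This file proves, curve-free:

* `valuation_four_sub_sq_le` (§0) — for a rational `3`-adic unit `q`: `v(4 − q²) ≤ t`.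
* `rho_quartic_of_hauptmodul_three` (§1) — `ρ⁴ − 16ρ³ + 72ρ² − 3Jρ + (21J − 432) = 0`.
* `valuation_rho_pow_three_eq` (§1) — `v(J) = 1`, `v(ρ + 2) = 1` ⟹ `v(ρ)³ = t`.
* `valuation_nine_sq_sub_pow_six` (§1) — then `v(9(2 + ρ)² − ρ⁶)³ = t⁷` (`ρ³ = 3J + D` with
  `v(D) = v(9ρ²)`, and `9(2 + ρ)² − ρ⁶ = 36ρ + [9(4 − J²) + 9ρ² − 6JD − D²]`, bracket `< v(36ρ)`).

Part 2 (`HauptmodulNineValuationFour`) adds the cube-root lemma and concludes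
`v(9θ²/(S − 6)² − 1)⁹ = t` — the `Stab(C)`-invariant of `3`-adic valuation `1/9` feeding the
scalar-stabiliser socket (`NineTorsionScalarStabiliserSocket`, p283350).  EVIDENCE kit j134538
(142/142 census cells with `v₃(j) = 4`).  Nothing booked.

References: [Maier2006] R. S. Maier, J. Ramanujan Math. Soc. 24 (2009), Table 4 (N = 3, 9), §5.
-/

noncomputable section

set_option maxRecDepth 10000

open scoped Classical

namespace Summit.BirchSwinnertonDyer.Rank1Residual.GaloisImage

open Literature.NumberTheory.EllipticCurves Literature.NumberTheory.GaloisRepresentations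
  Rat.HeightOneSpectrum

/-! ### §0 Rational bookkeeping: `J = j/81` is a `3`-adic unit and `3 ∣ 4 − J²` -/

/-- A rational with `v₃(q) = 0` has numerator and denominator prime to `3`. [folklore] -/
theorem not_dvd_num_den_of_padicValRat_eq_zero {q : ℚ} (hq : q ≠ 0) (hv : padicValRat 3 q = 0) :
    ¬ (3 : ℤ) ∣ q.num ∧ ¬ 3 ∣ q.den := by
  haveI : Fact (Nat.Prime 3) := ⟨Nat.prime_three⟩
  have hnum0 : q.num ≠ 0 := Rat.num_ne_zero.mpr hq
  have hdef : padicValRat 3 q = padicValInt 3 q.num - padicValNat 3 q.den := rfl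
  have hcop : Nat.Coprime q.num.natAbs q.den := q.reduced
  by_cases hn : (3 : ℤ) ∣ q.num
  · -- then `3 ∤ den`, so `v₃(q) ≥ 1`
    have hd : ¬ 3 ∣ q.den := by
      intro hd
      have h3 : 3 ∣ Nat.gcd q.num.natAbs q.den :=
        Nat.dvd_gcd (Int.natAbs_dvd_natAbs.mpr hn) hd
      rw [hcop] at h3
      omega
    have hvd : padicValNat 3 q.den = 0 := padicValNat.eq_zero_of_not_dvd hd
    have hvn : 1 ≤ padicValInt 3 q.num :=
      ((padicValInt_dvd_iff 1 q.num).mp (by simpa using hn)).resolve_left hnum0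
    rw [hdef, hvd] at hv
    push_cast at hv
    omega
  · refine ⟨hn, fun hd ↦ ?_⟩
    have hvn : padicValInt 3 q.num = 0 := padicValInt.eq_zero_of_not_dvd hn
    have hvd : 1 ≤ padicValNat 3 q.den :=
      Nat.one_le_iff_ne_zero.mpr (by
        intro h0
        rw [padicValNat.eq_zero_iff] at h0
        rcases h0 with h0 | h0 | h0
        · omega
        · exact q.den_nz h0
        · exact h0 hd)
    rw [hdef, hvn] at hv
    omega

/-- Non-zero elements of `ZMod 3` square to `1`. [folklore] -/
theorem sq_eq_one_of_ne_zero_zmod_three : ∀ x : ZMod 3, x ≠ 0 → x ^ 2 = 1 := by decide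

/-- `4·1 − 1 = 0` in `ZMod 3`. [folklore] -/
theorem four_mul_one_sub_one_zmod_three : (4 : ZMod 3) * 1 - 1 = 0 := by decide

/-- For a rational `3`-adic unit `q`: **`v(4 − q²) ≤ v(3)`** in `ℚ̄` (squares of units are
`≡ 1 (mod 3)`, so `3 ∣ 4 − q²`). [folklore] -/
theorem valuation_four_sub_sq_le {q : ℚ} (hq : q ≠ 0) (hv : padicValRat 3 q = 0) :
    (placeOver 3).valuation (algebraMap ℚ (AlgebraicClosure ℚ) (4 - q ^ 2)) ≤
      (placeOver 3).valuation (3 : AlgebraicClosure ℚ) := by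
  haveI : Fact (Nat.Prime 3) := ⟨Nat.prime_three⟩
  obtain ⟨hn, hd⟩ := not_dvd_num_den_of_padicValRat_eq_zero hq hv
  by_cases h0 : 4 - q ^ 2 = 0
  · rw [h0, map_zero, map_zero]; exact zero_le
  -- `4 - q² = (4 den² - num²)/den²` with `3 ∣ 4 den² - num²`
  set n := q.num with hnq
  set d := (q.den : ℤ) with hdq
  have hd0 : (d : ℚ) ≠ 0 := by rw [hdq]; exact_mod_cast q.den_nz
  have hq' : q = (n : ℚ) / d := by rw [hnq, hdq]; exact_mod_cast (Rat.num_div_den q).symm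
  have hexpr : 4 - q ^ 2 = ((4 * d ^ 2 - n ^ 2 : ℤ) : ℚ) / (d : ℚ) ^ 2 := by
    rw [hq']; push_cast; field_simp
  have h3dvd : (3 : ℤ) ∣ 4 * d ^ 2 - n ^ 2 := by
    have hn3 : (n : ZMod 3) ≠ 0 := by
      rw [Ne, ZMod.intCast_zmod_eq_zero_iff_dvd]; exact_mod_cast hn
    have hd3 : (d : ZMod 3) ≠ 0 := by
      rw [Ne, ZMod.intCast_zmod_eq_zero_iff_dvd, hdq]; exact_mod_cast hd
    have h' : ((4 * d ^ 2 - n ^ 2 : ℤ) : ZMod 3) = 0 := by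
      push_cast
      rw [sq_eq_one_of_ne_zero_zmod_three _ hn3, sq_eq_one_of_ne_zero_zmod_three _ hd3]
      exact four_mul_one_sub_one_zmod_three
    have := (ZMod.intCast_zmod_eq_zero_iff_dvd _ 3).mp h'
    exact_mod_cast this
  have hne : 4 * d ^ 2 - n ^ 2 ≠ 0 := by
    intro h
    apply h0
    rw [hexpr, h]
    simp
  obtain ⟨m, hm⟩ : ∃ m : ℕ, padicValRat 3 (4 - q ^ 2) = m ∧ 1 ≤ m := by
    have h1 : 1 ≤ padicValInt 3 (4 * d ^ 2 - n ^ 2) :=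
      ((padicValInt_dvd_iff 1 (4 * d ^ 2 - n ^ 2)).mp (by simpa using h3dvd)).resolve_left hne
    have hvd : padicValRat 3 (d : ℚ) = 0 := by
      rw [hdq, Int.cast_natCast, padicValRat.of_nat, padicValNat.eq_zero_of_not_dvd hd]
      rfl
    have hval : padicValRat 3 (4 - q ^ 2) = padicValInt 3 (4 * d ^ 2 - n ^ 2) := by
      rw [hexpr, padicValRat.div (by exact_mod_cast hne) (pow_ne_zero _ hd0), padicValRat.pow,
        hvd, padicValRat.of_int]
      ring
    exact ⟨padicValInt 3 (4 * d ^ 2 - n ^ 2), by rw [hval], h1⟩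
  have hv4 := valuation_ratCast_eq_pow_of_padicValRat h0 hm.1
  calc (placeOver 3).valuation (algebraMap ℚ (AlgebraicClosure ℚ) (4 - q ^ 2))
      = (placeOver 3).valuation (3 : AlgebraicClosure ℚ) ^ m := hv4
    _ ≤ (placeOver 3).valuation (3 : AlgebraicClosure ℚ) :=
        pow_le_of_le_one zero_le valuation_three_lt_one.le (by omega)


/-! ### §1 The quartic of the non-canonical level-`3` Hauptmodul: `v(ρ) = 1/3`, `v(9(2+ρ)² − ρ⁶) = 7/3` -/

/-- The level-`3` relation `j(S − 27) = S(S − 24)³`, rewritten for `ρ = S/3 − 2` and `J = j/81`: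
**`ρ⁴ − 16ρ³ + 72ρ² − 3Jρ + (21J − 432) = 0`** (`= (ρ + 2)(ρ − 6)³ − 3J(ρ − 7)`). [folklore] -/
theorem rho_quartic_of_hauptmodul_three {F : Type*} [Field F] [CharZero F] {j S : F}
    (hS : j * (S - 27) = S * (S - 24) ^ 3) :
    (S / 3 - 2) ^ 4 - 16 * (S / 3 - 2) ^ 3 + 72 * (S / 3 - 2) ^ 2 - 3 * (j / 81) * (S / 3 - 2) +
      (21 * (j / 81) - 432) = 0 := by
  linear_combination (-1 / 81 : F) * hS

/-- **`v(ρ)³ = v(3)`** for a root `ρ` of `ρ⁴ − 16ρ³ + 72ρ² − 3Jρ + (21J − 432)` with `v(J) = 1` and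
`v(ρ + 2) = 1` (i.e. `S = 3(ρ + 2)` has `v(S) = v(3)`: the non-canonical roots).  Upper bound:
`(ρ+2)((ρ+2)³ − 512) = 3(8(ρ+2)³ − 64(ρ+2)² + J(ρ+2) − 9J)` gives `v(ρ³ + 3(2ρ² + 4ρ − 168)) ≤ v(3)`;
lower bound: in the quartic, `3(7J − 144)` has valuation exactly `v(3)`. [folklore] -/
theorem valuation_rho_pow_three_eq {ρ J : AlgebraicClosure ℚ}
    (hJ : (placeOver 3).valuation J = 1) (hρ2 : (placeOver 3).valuation (ρ + 2) = 1)
    (hr : ρ ^ 4 - 16 * ρ ^ 3 + 72 * ρ ^ 2 - 3 * J * ρ + (21 * J - 432) = 0) :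
    (placeOver 3).valuation ρ ^ 3 = (placeOver 3).valuation (3 : AlgebraicClosure ℚ) := by
  set v := (placeOver 3).valuation with hv
  set t := v (3 : AlgebraicClosure ℚ) with ht
  have ht1 : t < 1 := valuation_three_lt_one
  have ht0 : t ≠ 0 := valuation_three_ne_zero
  have hle1 : ∀ n : ℕ, v (n : AlgebraicClosure ℚ) ≤ 1 := fun n ↦
    ((placeOver 3).valuation_le_one_iff _).mpr (natCast_mem (placeOver 3) n)
  -- `v(ρ) ≤ 1`
  have hρ1 : v ρ ≤ 1 := by
    have : ρ = (ρ + 2) - 2 := by ring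
    rw [this]
    refine (Valuation.map_sub _ _ _).trans (max_le hρ2.le ?_)
    exact_mod_cast hle1 2
  -- upper bound `v(ρ³) ≤ t`
  have hup : v ρ ^ 3 ≤ t := by
    have hid : (ρ + 2) * (ρ ^ 3 + 3 * (2 * ρ ^ 2 + 4 * ρ - 168)) =
        3 * (8 * (ρ + 2) ^ 3 - 64 * (ρ + 2) ^ 2 + J * (ρ + 2) - 9 * J) := by
      linear_combination hr
    have hB : v (8 * (ρ + 2) ^ 3 - 64 * (ρ + 2) ^ 2 + J * (ρ + 2) - 9 * J) ≤ 1 := by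
      refine (Valuation.map_sub _ _ _).trans (max_le ?_ ?_)
      · refine (Valuation.map_add _ _ _).trans (max_le ?_ ?_)
        · refine (Valuation.map_sub _ _ _).trans (max_le ?_ ?_)
          · rw [map_mul, map_pow, hρ2, one_pow, mul_one]; exact_mod_cast hle1 8
          · rw [map_mul, map_pow, hρ2, one_pow, mul_one]; exact_mod_cast hle1 64
        · rw [map_mul, hJ, hρ2, mul_one]
      · rw [map_mul, hJ, mul_one]; exact_mod_cast hle1 9
    have h1 : v (ρ ^ 3 + 3 * (2 * ρ ^ 2 + 4 * ρ - 168)) ≤ t := by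
      have := congrArg v hid
      rw [map_mul, map_mul, hρ2, one_mul] at this
      rw [this]
      calc t * v (8 * (ρ + 2) ^ 3 - 64 * (ρ + 2) ^ 2 + J * (ρ + 2) - 9 * J) ≤ t * 1 :=
            mul_le_mul' le_rfl hB
        _ = t := mul_one t
    have h2 : v (3 * (2 * ρ ^ 2 + 4 * ρ - 168)) ≤ t := by
      rw [map_mul]
      calc t * v (2 * ρ ^ 2 + 4 * ρ - 168) ≤ t * 1 := by
            refine mul_le_mul' le_rfl ((Valuation.map_sub _ _ _).trans (max_le ?_ ?_))
            · refine (Valuation.map_add _ _ _).trans (max_le ?_ ?_)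
              · rw [map_mul, map_pow]
                calc v 2 * v ρ ^ 2 ≤ 1 * 1 := mul_le_mul' (by exact_mod_cast hle1 2)
                      (pow_le_one₀ zero_le hρ1)
                  _ = 1 := mul_one 1
              · rw [map_mul]
                calc v 4 * v ρ ≤ 1 * 1 := mul_le_mul' (by exact_mod_cast hle1 4) hρ1
                  _ = 1 := mul_one 1
            · exact_mod_cast hle1 168
        _ = t := mul_one t
    have : ρ ^ 3 = (ρ ^ 3 + 3 * (2 * ρ ^ 2 + 4 * ρ - 168)) - 3 * (2 * ρ ^ 2 + 4 * ρ - 168) := by ring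
    rw [← map_pow, this]
    exact (Valuation.map_sub _ _ _).trans (max_le h1 h2)
  -- lower bound: if `v(ρ)³ < t` the quartic is dominated by `3(7J − 144)`, of valuation `t`
  refine le_antisymm hup (not_lt.mp fun hlt ↦ ?_)
  have hρlt1 : v ρ < 1 := by
    by_contra h
    rw [not_lt] at h
    have : (1 : _) ≤ v ρ ^ 3 := one_le_pow₀ h
    exact absurd (lt_of_le_of_lt this hlt) (not_lt.mpr ht1.le)
  have h7J : v (7 * J - 144) = 1 := by
    have h7 : v (7 * J) = 1 := by
      rw [map_mul, hJ, mul_one]; simpa using valuation_intCast_eq_one_of_not_dvd (n := 7) (by decide)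
    have h144 : v (144 : AlgebraicClosure ℚ) < v (7 * J) := by
      rw [h7, show (144 : AlgebraicClosure ℚ) = 16 * 3 ^ 2 by norm_num, map_mul, map_pow]
      calc v 16 * t ^ 2 ≤ 1 * t ^ 2 := mul_le_mul' (by exact_mod_cast hle1 16) le_rfl
        _ = t ^ 2 := one_mul _
        _ < 1 := pow_lt_one₀ zero_le ht1 (by norm_num)
    rw [valuation_sub_eq_of_lt h144, h7]
  have hL : v (3 * (7 * J - 144)) = t := by rw [map_mul, h7J, mul_one]
  have hid : 3 * (7 * J - 144) = -ρ ^ 4 + 16 * ρ ^ 3 - 72 * ρ ^ 2 + 3 * J * ρ := by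
    linear_combination hr
  have hR : v (-ρ ^ 4 + 16 * ρ ^ 3 - 72 * ρ ^ 2 + 3 * J * ρ) < t := by
    have l1 : v (-ρ ^ 4) < t := by
      rw [Valuation.map_neg, map_pow]
      calc v ρ ^ 4 = v ρ ^ 3 * v ρ := pow_succ _ _
        _ ≤ v ρ ^ 3 * 1 := mul_le_mul' le_rfl hρ1
        _ = v ρ ^ 3 := mul_one _
        _ < t := hlt
    have l2 : v (16 * ρ ^ 3) < t := by
      rw [map_mul, map_pow]
      calc v 16 * v ρ ^ 3 ≤ 1 * v ρ ^ 3 := mul_le_mul' (by exact_mod_cast hle1 16) le_rfl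
        _ = v ρ ^ 3 := one_mul _
        _ < t := hlt
    have l3 : v (72 * ρ ^ 2) < t := by
      rw [show (72 : AlgebraicClosure ℚ) = 8 * 3 ^ 2 by norm_num, map_mul, map_mul, map_pow, map_pow]
      calc v 8 * t ^ 2 * v ρ ^ 2 ≤ 1 * t ^ 2 * 1 :=
            mul_le_mul' (mul_le_mul' (by exact_mod_cast hle1 8) le_rfl) (pow_le_one₀ zero_le hρ1)
        _ = t ^ 2 := by rw [one_mul, mul_one]
        _ < t := by
          conv_rhs => rw [← pow_one t]
          exact (pow_lt_pow_iff_of_lt_one' ht0 ht1).mpr (by norm_num)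
    have l4 : v (3 * J * ρ) < t := by
      rw [map_mul, map_mul, hJ, mul_one]
      calc t * v ρ < t * 1 := mul_lt_mul_of_pos_left hρlt1 (zero_lt_iff.mpr ht0)
        _ = t := mul_one t
    exact Valuation.map_add_lt _ (Valuation.map_sub_lt _ (Valuation.map_add_lt _ l1 l2) l3) l4
  rw [← hid] at hR
  exact absurd hL hR.ne

/-- **`v(9(2 + ρ)² − ρ⁶)³ = v(3)⁷`** under the same quartic, `v(ρ)³ = v(3)`, `v(J) = 1` and
`v(4 − J²) ≤ v(3)`: with `D = ρ³ − 3J` one has `D(16 − ρ) = 9(8ρ² − 3J − 48)`, so `v(D) = v(9ρ²)`,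
and `9(2 + ρ)² − ρ⁶ = 9(4 − J²) + 36ρ + 9ρ² − 6JD − D²` is dominated by `36ρ`. [folklore] -/
theorem valuation_nine_sq_sub_pow_six {ρ J : AlgebraicClosure ℚ}
    (hJ : (placeOver 3).valuation J = 1)
    (hJ2 : (placeOver 3).valuation (4 - J ^ 2) ≤ (placeOver 3).valuation (3 : AlgebraicClosure ℚ))
    (hr : ρ ^ 4 - 16 * ρ ^ 3 + 72 * ρ ^ 2 - 3 * J * ρ + (21 * J - 432) = 0)
    (hρ : (placeOver 3).valuation ρ ^ 3 = (placeOver 3).valuation (3 : AlgebraicClosure ℚ)) :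
    (placeOver 3).valuation (9 * (2 + ρ) ^ 2 - ρ ^ 6) ^ 3 =
      (placeOver 3).valuation (3 : AlgebraicClosure ℚ) ^ 7 := by
  set v := (placeOver 3).valuation with hv
  set t := v (3 : AlgebraicClosure ℚ) with ht
  have ht1 : t < 1 := valuation_three_lt_one
  have ht0 : t ≠ 0 := valuation_three_ne_zero
  have hle1 : ∀ n : ℕ, v (n : AlgebraicClosure ℚ) ≤ 1 := fun n ↦
    ((placeOver 3).valuation_le_one_iff _).mpr (natCast_mem (placeOver 3) n)
  set s := v ρ with hs
  -- comparison of monomials `s^a t^b` through cubes: `(s^a t^b)^3 = t^(a + 3b)`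
  have hs0 : s ≠ 0 := by intro h0; rw [h0, zero_pow (by norm_num)] at hρ; exact ht0 hρ.symm
  have cube : ∀ a b : ℕ, (s ^ a * t ^ b) ^ 3 = t ^ (a + 3 * b) := by
    intro a b
    rw [mul_pow, ← pow_mul, ← pow_mul, show s ^ (a * 3) = t ^ a by rw [mul_comm, pow_mul, hρ],
      ← pow_add, show a + b * 3 = a + 3 * b by ring]
  have hlt : ∀ {a b a' b' : ℕ}, a' + 3 * b' < a + 3 * b → s ^ a * t ^ b < s ^ a' * t ^ b' := by
    intro a b a' b' h
    refine lt_of_pow_lt_pow_left₀ 3 zero_le ?_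
    rw [cube, cube]
    exact (pow_lt_pow_iff_of_lt_one' ht0 ht1).mpr h
  have hs1 : s < 1 := by simpa using hlt (a := 1) (b := 0) (a' := 0) (b' := 0) (by norm_num)
  have hv9 : v (9 : AlgebraicClosure ℚ) = t ^ 2 := by
    rw [show (9 : AlgebraicClosure ℚ) = 3 ^ 2 by norm_num, map_pow]
  have hv36 : v (36 : AlgebraicClosure ℚ) = t ^ 2 := by
    rw [show (36 : AlgebraicClosure ℚ) = 4 * 3 ^ 2 by norm_num, map_mul, map_pow]
    have : v (4 : AlgebraicClosure ℚ) = 1 := by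
      simpa using valuation_intCast_eq_one_of_not_dvd (n := 4) (by decide)
    rw [this, one_mul]
  -- `D = ρ³ − 3J`, `v(D) = t² s²`
  have hD : (ρ ^ 3 - 3 * J) * (16 - ρ) = 9 * (8 * ρ ^ 2 - (3 * J + 48)) := by
    linear_combination (-1 : AlgebraicClosure ℚ) * hr
  have h16 : v (16 - ρ) = 1 := by
    have : v ρ < v (16 : AlgebraicClosure ℚ) := by
      rw [show v (16 : AlgebraicClosure ℚ) = 1 by
        simpa using valuation_intCast_eq_one_of_not_dvd (n := 16) (by decide)]
      exact hs1
    rw [valuation_sub_eq_of_lt this]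
    simpa using valuation_intCast_eq_one_of_not_dvd (n := 16) (by decide)
  have hB : v (8 * ρ ^ 2 - (3 * J + 48)) = s ^ 2 := by
    have h8 : v (8 * ρ ^ 2) = s ^ 2 := by
      rw [map_mul, map_pow, show v (8 : AlgebraicClosure ℚ) = 1 by
        simpa using valuation_intCast_eq_one_of_not_dvd (n := 8) (by decide), one_mul]
    have hsmall : v (3 * J + 48) < v (8 * ρ ^ 2) := by
      rw [h8]
      have h3J : v (3 * J) ≤ t := by rw [map_mul, hJ, mul_one]
      have h48 : v (48 : AlgebraicClosure ℚ) ≤ t := by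
        rw [show (48 : AlgebraicClosure ℚ) = 16 * 3 by norm_num, map_mul]
        calc v 16 * t ≤ 1 * t := mul_le_mul' (by exact_mod_cast hle1 16) le_rfl
          _ = t := one_mul t
      calc v (3 * J + 48) ≤ max (v (3 * J)) (v 48) := Valuation.map_add _ _ _
        _ ≤ t := max_le h3J h48
        _ = s ^ 0 * t ^ 1 := by rw [pow_zero, one_mul, pow_one]
        _ < s ^ 2 * t ^ 0 := hlt (by norm_num)
        _ = s ^ 2 := by rw [pow_zero, mul_one]
    rw [valuation_sub_eq_of_lt hsmall, h8]
  have hvD : v (ρ ^ 3 - 3 * J) = t ^ 2 * s ^ 2 := by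
    have := congrArg v hD
    rw [map_mul, map_mul, h16, mul_one, hv9, hB] at this
    exact this
  -- the identity and the domination by `36ρ`
  have hN : 9 * (2 + ρ) ^ 2 - ρ ^ 6 =
      36 * ρ + (9 * (4 - J ^ 2) + 9 * ρ ^ 2 - 6 * J * (ρ ^ 3 - 3 * J) - (ρ ^ 3 - 3 * J) ^ 2) := by
    ring
  have hmain : v (36 * ρ) = t ^ 2 * s := by rw [map_mul, hv36]
  have l1 : v (9 * (4 - J ^ 2)) < t ^ 2 * s := by
    rw [map_mul, hv9]
    calc t ^ 2 * v (4 - J ^ 2) ≤ t ^ 2 * t := mul_le_mul' le_rfl hJ2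
      _ = s ^ 0 * t ^ 3 := by rw [pow_zero, one_mul, ← pow_succ]
      _ < s ^ 1 * t ^ 2 := hlt (by norm_num)
      _ = t ^ 2 * s := by rw [pow_one, mul_comm]
  have l2 : v (9 * ρ ^ 2) < t ^ 2 * s := by
    rw [map_mul, hv9, map_pow]
    calc t ^ 2 * s ^ 2 = s ^ 2 * t ^ 2 := mul_comm _ _
      _ < s ^ 1 * t ^ 2 := hlt (by norm_num)
      _ = t ^ 2 * s := by rw [pow_one, mul_comm]
  have l3 : v (6 * J * (ρ ^ 3 - 3 * J)) < t ^ 2 * s := by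
    rw [map_mul, map_mul, hJ, mul_one, hvD, show (6 : AlgebraicClosure ℚ) = 2 * 3 by norm_num, map_mul,
      show v (2 : AlgebraicClosure ℚ) = 1 by simpa using valuation_intCast_eq_one_of_not_dvd (n := 2) (by decide),
      one_mul]
    calc t * (t ^ 2 * s ^ 2) = s ^ 2 * t ^ 3 := by
          simp only [pow_succ, pow_zero, one_mul, mul_comm, mul_left_comm]
      _ < s ^ 1 * t ^ 2 := hlt (by norm_num)
      _ = t ^ 2 * s := by rw [pow_one, mul_comm]
  have l4 : v ((ρ ^ 3 - 3 * J) ^ 2) < t ^ 2 * s := by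
    rw [map_pow, hvD]
    calc (t ^ 2 * s ^ 2) ^ 2 = s ^ 4 * t ^ 4 := by
          simp only [pow_succ, pow_zero, one_mul, mul_comm, mul_left_comm]
      _ < s ^ 1 * t ^ 2 := hlt (by norm_num)
      _ = t ^ 2 * s := by rw [pow_one, mul_comm]
  have hrest : v (9 * (4 - J ^ 2) + 9 * ρ ^ 2 - 6 * J * (ρ ^ 3 - 3 * J) - (ρ ^ 3 - 3 * J) ^ 2) <
      v (36 * ρ) := by
    rw [hmain]
    exact Valuation.map_sub_lt _ (Valuation.map_sub_lt _ (Valuation.map_add_lt _ l1 l2) l3) l4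
  rw [hN, Valuation.map_add_eq_of_lt_left _ hrest, hmain, mul_pow, ← pow_mul, hρ, ← pow_succ]

end Summit.BirchSwinnertonDyer.Rank1Residual.GaloisImage
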